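import Mathlib
import Summits.ResolutionOfSingularities.ResolutionOfSingularities.Theorems.WildQuotientsWildQuotientResolutionLinearSmallBlocksAlgebra
import Summits.ResolutionOfSingularities.ResolutionOfSingularities.Theorems.WildQuotientsWildQuotientResolutionTameStackyCyclicTransfer
import Literature.AlgebraicGeometry.Resolution.ProjectiveSpaceRegular

/-!
# Rung LSB, trivial branch: with no moving coordinate the quotient is `𝔸ⁿ` itself (chain w45c)

(crux stmt-ResolutionOfSingularities-15640 `WildQuotients.WildQuotientResolution`, line `Sketch`;
rung LSB of `L/w45c/CHAIN.md` v3, the `D = ∅` branch of candidate (5)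
`linearSmallBlocks_hasResolution`; [OURS · L1 W4.5c] — NOT a statement of any manuscript.)

If the set `D` of moved coordinates is empty, the coordinate action `σ` is the identity
(`LinearSmallBlocks.eq_one_of_empty`), its cyclic group is trivial, the invariant subalgebra is
all of `k[x₀,…,x_{n-1}]` (`TameTransfer.fixedPoints_zpowers_one_eq_top`), and the quotient
`Spec k[x]^⟨σ⟩ ≅ 𝔸ⁿ` is regular, hence has a resolution (the identity):
`hasResolution_fixedPoints_zpowers_one`, `hasResolution_of_empty`.
-/

-- single-problem summit: the doubled namespace component `ResolutionOfSingularities` is forced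
set_option linter.dupNamespace false

noncomputable section

open MvPolynomial AlgebraicGeometry CategoryTheory Literature.AlgebraicGeometry.Resolution

namespace Summit.ResolutionOfSingularities.ResolutionOfSingularities.Theorems.WildQuotientResolution.LinearSmallBlocks

/-- **The quotient by the trivial cyclic group is `Spec U` itself, which has a resolution when `U`
is a regular ring** (`U^⟨1⟩ = U`, `TameTransfer.fixedPoints_zpowers_one_eq_top`; the spectrum of a
regular ring is regular, and a regular scheme is its own resolution). [folklore] -/
theorem hasResolution_fixedPoints_zpowers_one (k U : Type) [Field k] [CommRing U] [Algebra k U]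
    [IsRegularRing U] :
    Scheme.HasResolution
      (Spec (.of (FixedPoints.subalgebra k U (Subgroup.zpowers (1 : U ≃ₐ[k] U))))) := by
  have htop := TameTransfer.fixedPoints_zpowers_one_eq_top k U
  let e : FixedPoints.subalgebra k U (Subgroup.zpowers (1 : U ≃ₐ[k] U)) ≃ₐ[k] U :=
    (Subalgebra.equivOfEq _ _ htop).trans Subalgebra.topEquiv
  haveI : IsRegularRing (FixedPoints.subalgebra k U (Subgroup.zpowers (1 : U ≃ₐ[k] U))) :=
    IsRegularRing.of_ringEquiv e.toRingEquiv.symm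
  exact (Scheme.isRegular_Spec _).hasResolution

/-- **Rung LSB, `D = ∅`**: a coordinate action moving no coordinate is the identity, and its
quotient `Spec k[x]^⟨σ⟩ = 𝔸ⁿ` has a resolution of singularities. [folklore] -/
theorem hasResolution_of_empty (k : Type) [Field k] (n : ℕ)
    (σ : MvPolynomial (Fin n) k ≃ₐ[k] MvPolynomial (Fin n) k) (D : Finset (Fin n))
    (hσ : ∀ i ∉ D, σ (X i) = X i) (hD : D = ∅) :
    Scheme.HasResolution
      (Spec (.of (FixedPoints.subalgebra k (MvPolynomial (Fin n) k) (Subgroup.zpowers σ)))) := by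
  have h1 : σ = 1 := eq_one_of_empty k n σ D hσ hD
  subst h1
  exact hasResolution_fixedPoints_zpowers_one k (MvPolynomial (Fin n) k)

end Summit.ResolutionOfSingularities.ResolutionOfSingularities.Theorems.WildQuotientResolution.LinearSmallBlocks

end
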